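import Literature.AlgebraicGeometry.HodgeTheory.WeilClassesFieldDefiniteQuaternionMatricesExceptional
import Literature.AlgebraicGeometry.HodgeTheory.WeilClassesFieldSubringMatricesDecomposable
import HarnessLib

/-!
# Moonen–Zarhin's Criterion (2), TYPE 3 ON POWERS, FROM `End(A)`-LEVEL DATA: «`End⁰(A) = ℚ⟨ψ, α, β⟩` a definite
# quaternion algebra» ⟹ the parity dichotomy for `W_F(A^{n+1})` (Moonen–Zarhin 1998 §1, Criterion (2), case «Y of
# Type 3», both directions, on the carrier)

Layer `Literature/AlgebraicGeometry/HodgeTheory`; THEOREMS ONLY — no definition, no named fact, no `sorry` (D-0026, net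
debt 0).  End-level wrapper of the seat's `WeilClassesFieldDefiniteQuaternionMatricesDecomposable` (g23-#2, «even ⟹
decomposable») and `WeilClassesFieldDefiniteQuaternionMatricesExceptional` (g23-#4, «odd ⟹ exceptional», the two `iff`s),
in the format of the seat's `WeilClassesFieldQuaternionEndLevel` / `WeilClassesFieldSubringMatricesDecomposable`: the
relations of `ψ, α, β` are stated in the ring `End(A)`, and the hypothesis «every pull-back `χ^*` of `A^{n+1}` lies in
`ℂ⟨(⊕ψ)^*, (⊕α)^*, (⊕β)^*, (πₐ ≫ ι_b)^*⟩» of g23-#4 is DISCHARGED from «`End⁰(A) = ℚ⟨ψ, α, β⟩`»: every endomorphism of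
`A` has a non-zero integer multiple in the subring `ℤ⟨ψ, α, β⟩`.

## The print

B. J. J. Moonen, Yu. G. Zarhin, *Weil classes on abelian varieties*, J. reine angew. Math. **496** (1998) 83–92 =
arXiv:alg-geom/9612017 [MoonenZarhin1998WeilClasses] (held text `paper:arxiv-alg-geom_9612017`), §1, VERBATIM: «We may
from now on restrict our attention to the case that `k = 1`. … we may even assume that `X = Y^m` for some `m ≥ 1`, where
`Y` is simple.  Let `D = End⁰(Y)`, let `E` be the center of `D` …» (chunk p0002 L43–L51); Table 1: `End⁰(X) = M_m(D)`,
type 3: `B = M_m(D)` for `m ≥ 2` (chunk p0002 L60–L84); Criterion (2): «either all classes in `W_F` are decomposable, or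
all non-zero classes in `W_F` are exceptional; this last possibility occurs precisely in the following cases: … `Y` is of
Type 3, `m ≥ 2` and the integer `2m · [E:ℚ] / [F:ℚ]` is odd, …» (chunk p0003 L46–L60) and its proof, type 3 (chunk
p0003 L92–L111; p0004 L1–L27).
H. Lange, Ch. Birkenhake, *Complex Abelian Varieties* [LangeBirkenhake1992], §1.1 (the rational representation
`End(A) → End(H¹)`), Ch. 5 §5 (type III: `End⁰ = ` a totally definite quaternion algebra over a totally real field, Rosati
= quaternion conjugation; held PDF p. 138).

## What is proved (`X = A^{n+1}`, product polarization, on `H¹(X(ℂ); ℂ)`)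

* **`pullbackOne_mem_adjoin_diagonal_of_forall_exists_zsmul_mem_closure_triple`** — if every `g ∈ End(A)` has some
  `N g ∈ ℤ⟨ψ, α, β⟩`, `N ≠ 0`, then every `χ^*`, `χ ∈ End(A^{n+1})`, lies in `ℂ⟨(⊕ψ)^*, (⊕α)^*, (⊕β)^*, (πₐ ≫ ι_b)^*⟩`
  (clear the denominators of the `(n+1)²` entries; the seat's `pullbackOne_mem_adjoin_diagonal_of_entry_mem_closure_triple`).
* **`weilClassesField_biproduct_le_divisorClassesSpan_iff_forall_dvd_of_definiteQuaternionOver_End`**,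
  **`weilClassesField_biproduct_inf_divisorClassesSpan_eq_bot_iff_exists_odd_of_definiteQuaternionOver_End`** — THE
  DICHOTOMY FROM `End(A)`: for `ψ` Rosati-symmetric with `Q(ψ) = 0`, `α, β` Rosati-skew with `ψα = αψ`, `ψβ = βψ`,
  `αβ = -βα`, `α² = a(ψ)`, `β² = b(ψ)` in `End(A)` (`a, b ∈ ℤ[X]` non-vanishing at the roots of `Q`), `End⁰(A) =
  ℚ⟨ψ, α, β⟩`, and `φ ∈ End(A^{n+1})` with `P(φ) = 0`: `W_F ⊗ ℂ ≤ 𝒟ᵐ ⊗ ℂ` iff every per-place exponent is even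
  (`dim ker(ψ^* - z) ∣ dim(V_ρ ∩ ker((⊕ψ)^* - z))`), `W_F ⊗ ℂ ⊓ 𝒟ᵐ ⊗ ℂ = ⊥` iff some per-place exponent is odd.
* **`…_le_divisorClassesSpan_iff_dvd_of_definiteQuaternion_End`**, **`…_inf_divisorClassesSpan_eq_bot_iff_not_dvd_of_
  definiteQuaternion_End`** — centre `ℚ` (`α² = [a]`, `β² = [b]`, `End⁰(A) = ℚ⟨α, β⟩`): `W_F ⊗ ℂ ≤ 𝒟ᵐ ⊗ ℂ ↔ dim A ∣ m`
  and `W_F ⊗ ℂ ⊓ 𝒟ᵐ ⊗ ℂ = ⊥ ↔ dim A ∤ m` («`2m′/[F:ℚ]` even / odd», `m′ = n + 1`).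

## Scope (honest column)

As in g23-#2/#4: no Albert classification, simplicity or `X ∼ Y^m` is used — the type-3 structure is the PRESENTATION
`ψ, α, β` of `End⁰(A)` with the stated Rosati signs, and «`End⁰(A) = D`» is the hypothesis `hD` (integral, with
denominators cleared; that a simple complex abelian variety of type III admits such a presentation is the print's Table 1
and Albert's classification, NOT proved here).  The parity is per place and per root (`Σ_z l_z(ρ)` is the print's
`2m[E:ℚ]/[F:ℚ]`; they agree for `E ⊆ F` or `[E:ℚ] = 1` — honest column of `WeilClassesFieldOrthogonalCornersParity`).
`h` is any class with `h^{dim A} ≠ 0` and `Q_h` non-degenerate; everything is on `ℂ`-points of Milne's `S(X)(D_X)`.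

## References

* [MoonenZarhin1998WeilClasses] B. J. J. Moonen, Yu. G. Zarhin, Weil classes on abelian varieties, J. reine angew.
  Math. 496 (1998) 83–92; arXiv:alg-geom/9612017: §1 (chunk p0002 L43–L118), Criterion (2) and its proof, type 3
  (chunk p0003 L46–L60, L92–L111; p0004 L1–L27).
* [Milne1999LefschetzClasses] J. S. Milne, Lefschetz classes on abelian varieties, Duke Math. J. 96 (1999), §1 p. 643,
  Thm. 3.2, Cor. 4.5.
* [LangeBirkenhake1992] H. Lange, Ch. Birkenhake, Complex Abelian Varieties, Grundlehren 302 (1992), §1.1, Ch. 5 §5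
  (PDF p. 138).

## Provenance

Lane `lit-hodgefound` (Track 2, Layer A), prover seat `lit-hodgefound-p21` (generation 23), row g23-#5 (End-level form of
g23-#2/#4).
-/

noncomputable section

open CategoryTheory CategoryTheory.Limits
open Literature.AlgebraicTopology.SingularHomology
open Literature.AlgebraicGeometry.Motives
open Literature.AlgebraicGeometry.VanGeemen1994 (hodgeClassSpan pullbackOne)
open Literature.AlgebraicGeometry.Milne1999
open Literature.Geometry.Kaehler (lefschetzPow)
open Literature.Barriers.HodgeConjecture (divisorClassesSpan)
open Polynomial

namespace Literature.AlgebraicGeometry.HodgeTheory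

/-! ### §1 «`End⁰(A) = ℚ⟨ψ, α, β⟩`» ⟹ every pull-back of `A^{n+1}` lies in `ℂ⟨(⊕ψ)^*, (⊕α)^*, (⊕β)^*, (πₐ ≫ ι_b)^*⟩` -/

section EndLevel

variable {A : AbelianVariety ℂ} {h : complexBetti A.X 2} {n : ℕ} {ψ α β : A ⟶ A} {qa qb : Polynomial ℤ} {a b : ℤ}
  {φ : ⨁ (fun _ : Fin (n + 1) => A) ⟶ ⨁ (fun _ : Fin (n + 1) => A)} {P Q : Polynomial ℤ} {e m : ℕ}

/-- **`End⁰(A) = ℚ⟨ψ, α, β⟩ ⟹ End⁰(A^{n+1}) ⊗ ℂ` acts inside `ℂ⟨(⊕ψ)^*, (⊕α)^*, (⊕β)^*, (πₐ ≫ ι_b)^*⟩`.**  If every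
endomorphism `g` of `A` has a non-zero integer multiple in the subring `ℤ⟨ψ, α, β⟩ ⊆ End(A)` («`End⁰(A) = D =
ℚ⟨ψ, α, β⟩`»), then for every `χ ∈ End(A^{n+1}) = M_{n+1}(End A)` the pull-back `χ^*` lies in the complex algebra
generated by the diagonals and the matrix units: clear the denominators of the `(n+1)²` entries at once and use the seat's
`pullbackOne_mem_adjoin_diagonal_of_entry_mem_closure_triple` («`End⁰(X) = M_m(End⁰ Y)`»).
[cite: MoonenZarhin1998WeilClasses, §1 Table 1 («X = Y^m, End⁰(X) = M_m(D)»; chunk p0002 L60–L84)] [cite: LangeBirkenhake1992, §1.1] -/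
theorem pullbackOne_mem_adjoin_diagonal_of_forall_exists_zsmul_mem_closure_triple
    (hD : ∀ g : A ⟶ A, ∃ N : ℤ, N ≠ 0 ∧ End.of (N • g) ∈ Subring.closure {End.of ψ, End.of α, End.of β})
    (χ : (⨁ (fun _ : Fin (n + 1) => A)) ⟶ (⨁ (fun _ : Fin (n + 1) => A))) :
    pullbackOne (⨁ (fun _ : Fin (n + 1) => A)) χ ∈ Algebra.adjoin ℂ
      (insert (pullbackOne (⨁ (fun _ : Fin (n + 1) => A)) (biproduct.map fun _ : Fin (n + 1) => ψ))
        (insert (pullbackOne (⨁ (fun _ : Fin (n + 1) => A)) (biproduct.map fun _ : Fin (n + 1) => α))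
          (insert (pullbackOne (⨁ (fun _ : Fin (n + 1) => A)) (biproduct.map fun _ : Fin (n + 1) => β))
            (Set.range fun ab : Fin (n + 1) × Fin (n + 1) ↦ pullbackOne (⨁ (fun _ : Fin (n + 1) => A))
              (biproduct.π (fun _ : Fin (n + 1) => A) ab.1 ≫ biproduct.ι (fun _ : Fin (n + 1) => A) ab.2))))) := by
  classical
  choose N hN0 hN using hD
  set g : Fin (n + 1) × Fin (n + 1) → (A ⟶ A) := fun ab ↦
    biproduct.ι (fun _ : Fin (n + 1) => A) ab.1 ≫ χ ≫ biproduct.π (fun _ : Fin (n + 1) => A) ab.2 with hgdef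
  set M : ℤ := ∏ ab, N (g ab) with hMdef
  have hM0 : M ≠ 0 := Finset.prod_ne_zero_iff.2 fun ab _ ↦ hN0 (g ab)
  have hentry : ∀ a b, End.of (biproduct.ι (fun _ : Fin (n + 1) => A) a ≫ (M • χ) ≫
      biproduct.π (fun _ : Fin (n + 1) => A) b) ∈ Subring.closure {End.of ψ, End.of α, End.of β} := by
    intro a b
    have e1 : biproduct.ι (fun _ : Fin (n + 1) => A) a ≫ (M • χ) ≫ biproduct.π (fun _ : Fin (n + 1) => A) b =
        (∏ cd ∈ Finset.univ.erase (a, b), N (g cd)) • (N (g (a, b)) • g (a, b)) := by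
      rw [Preadditive.zsmul_comp, Preadditive.comp_zsmul, smul_smul, Finset.prod_erase_mul _ _ (Finset.mem_univ _)]
    rw [e1]
    exact Subring.zsmul_mem _ (hN (g (a, b))) _
  have hmem := pullbackOne_mem_adjoin_diagonal_of_entry_mem_closure_triple (ψ := ψ) (α := α) (β := β) hentry
  rw [pullbackOne_zsmul] at hmem
  have e2 : pullbackOne (⨁ (fun _ : Fin (n + 1) => A)) χ = ((M : ℂ)⁻¹) • ((M : ℂ) • pullbackOne (⨁ (fun _ : Fin (n + 1) => A)) χ) := by
    rw [smul_smul, inv_mul_cancel₀ (Int.cast_ne_zero.2 hM0), one_smul]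
  rw [e2]
  exact Subalgebra.smul_mem _ hmem _

/-! ### §2 MOONEN–ZARHIN's CRITERION (2), TYPE 3 ON POWERS, FROM `End(A)`: the dichotomy -/

/-- **TYPE 3 ON POWERS FROM `End(A)` — THE DICHOTOMY, DECOMPOSABLE SIDE.**  Let `A` be a complex abelian variety of
positive dimension with `h ∈ B¹(A) ⊗ ℂ`, `h^{dim A} ≠ 0`, `Q_h` non-degenerate, and `ψ, α, β ∈ End(A)` with: `ψ`
Rosati-symmetric, `Q(ψ) = 0` (`Q` monic irreducible over `ℚ`); `α, β` ROSATI-SKEW, `ψα = αψ`, `ψβ = βψ`, `αβ = -βα`,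
`α² = a(ψ)`, `β² = b(ψ)` (`a, b ∈ ℤ[X]` non-vanishing at the complex roots of `Q`); and «`End⁰(A) = ℚ⟨ψ, α, β⟩`»: every
`g ∈ End(A)` has a non-zero integer multiple in `ℤ⟨ψ, α, β⟩` — a presentation of `End⁰(A)` as a definite quaternion
algebra `D` over the totally real field `E = ℚ(ψ)`, type III.  Then for `X = A^{n+1}` with the product polarization and
any `φ ∈ End(X)` with `P(φ) = 0` (`P` monic irreducible of degree `e`, `e · 2m = 2(n+1) dim A`): `W_F ⊗ ℂ ≤ 𝒟ᵐ ⊗ ℂ` IFF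
`dim ker(ψ^* - z) ∣ dim(V_ρ ∩ ker((⊕ψ)^* - z))` for every complex root `ρ` of `P` and `z` of `Q` (every per-place
exponent even).  All algebra is stated in `End(A)` and transported to `H¹` by the seat's `WeilClassesFieldQuaternionEndLevel`
§1; then `weilClassesField_biproduct_le_divisorClassesSpan_iff_forall_dvd_of_forall_mem_adjoin_definiteQuaternionOver_diagonal`.
[cite: MoonenZarhin1998WeilClasses, §1 Criterion (2), case «Type 3, m ≥ 2» and its proof (chunk p0003 L46–L60, L92–L111; p0004 L1–L27); Tables 1–2 (chunk p0002 L60–L118)]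
[cite: Milne1999LefschetzClasses, §1 p. 643, Thm. 3.2, Cor. 4.5] [cite: LangeBirkenhake1992, §1.1, Ch. 5 §5 (PDF p. 138)] -/
theorem weilClassesField_biproduct_le_divisorClassesSpan_iff_forall_dvd_of_definiteQuaternionOver_End
    (hA : 0 < A.dim) (hh : h ∈ hodgeClassSpan A.dim A.X 1) (htop : lefschetzPow h (A.dim - 1) 2 h ≠ 0)
    (hnd : ∀ x : complexBetti A.X 1, (∀ y, polarizationPairingOne A.X h (A.dim - 1) x y = 0) → x = 0)
    (hψsym : ∀ v w : complexBetti A.X 1, polarizationPairingOne A.X h (A.dim - 1) (pullbackOne A ψ v) w =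
      polarizationPairingOne A.X h (A.dim - 1) v (pullbackOne A ψ w))
    (hQm : Q.Monic) (hQirr : Irreducible (Q.map (Int.castRingHom ℚ)))
    (hψQ : Polynomial.eval₂ (Int.castRingHom (CategoryTheory.End A)) (ψ : CategoryTheory.End A) Q = 0)
    (hα2 : α ≫ α = Polynomial.eval₂ (Int.castRingHom (CategoryTheory.End A)) (ψ : CategoryTheory.End A) qa)
    (hqa : ∀ z : ℂ, (Q.map (Int.castRingHom ℂ)).IsRoot z → (qa.map (Int.castRingHom ℂ)).eval z ≠ 0)
    (hβ2 : β ≫ β = Polynomial.eval₂ (Int.castRingHom (CategoryTheory.End A)) (ψ : CategoryTheory.End A) qb)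
    (hqb : ∀ z : ℂ, (Q.map (Int.castRingHom ℂ)).IsRoot z → (qb.map (Int.castRingHom ℂ)).eval z ≠ 0)
    (hanti : α ≫ β = -(β ≫ α))
    (hαskew : ∀ v w : complexBetti A.X 1, polarizationPairingOne A.X h (A.dim - 1) (pullbackOne A α v) w =
      -polarizationPairingOne A.X h (A.dim - 1) v (pullbackOne A α w))
    (hβskew : ∀ v w : complexBetti A.X 1, polarizationPairingOne A.X h (A.dim - 1) (pullbackOne A β v) w =
      -polarizationPairingOne A.X h (A.dim - 1) v (pullbackOne A β w))
    (hψα : ψ ≫ α = α ≫ ψ) (hψβ : ψ ≫ β = β ≫ ψ)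
    (hD : ∀ g : A ⟶ A, ∃ N : ℤ, N ≠ 0 ∧ End.of (N • g) ∈ Subring.closure {End.of ψ, End.of α, End.of β})
    (hPm : P.Monic) (hPe : P.natDegree = e) (hPirr : Irreducible (P.map (Int.castRingHom ℚ)))
    (hφ : Polynomial.eval₂ (Int.castRingHom (CategoryTheory.End (⨁ (fun _ : Fin (n + 1) => A))))
      (φ : CategoryTheory.End (⨁ (fun _ : Fin (n + 1) => A))) P = 0)
    (her : e * (2 * m) = 2 * ((n + 1) * A.dim)) :
    weilClassesField (⨁ (fun _ : Fin (n + 1) => A)) φ P (2 * m) ≤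
        divisorClassesSpan (⨁ (fun _ : Fin (n + 1) => A)).X (⨁ (fun _ : Fin (n + 1) => A)).dim m ↔
      ∀ ρ : ℂ, Polynomial.eval₂ (Int.castRingHom ℂ) ρ P = 0 → ∀ z : ℂ, (Q.map (Int.castRingHom ℂ)).IsRoot z →
        Module.finrank ℂ ↥((pullbackOne A ψ).eigenspace z) ∣
          Module.finrank ℂ ↥((pullbackOne (⨁ (fun _ : Fin (n + 1) => A)) φ).eigenspace ρ ⊓
          (pullbackOne (⨁ (fun _ : Fin (n + 1) => A)) (biproduct.map fun _ : Fin (n + 1) => ψ)).eigenspace z) := by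
  have hα2' : pullbackOne A α * pullbackOne A α = aeval (pullbackOne A ψ) (qa.map (Int.castRingHom ℂ)) := by
    rw [← pullbackOne_comp_eq_mul, hα2]
    exact pullbackOne_eval₂ ψ qa
  have hβ2' : pullbackOne A β * pullbackOne A β = aeval (pullbackOne A ψ) (qb.map (Int.castRingHom ℂ)) := by
    rw [← pullbackOne_comp_eq_mul, hβ2]
    exact pullbackOne_eval₂ ψ qb
  have hanti' : pullbackOne A α * pullbackOne A β = -(pullbackOne A β * pullbackOne A α) := by
    rw [← pullbackOne_comp_eq_mul, hanti, pullbackOne_neg_eq_neg, pullbackOne_comp_eq_mul]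
  have hψα' : pullbackOne A ψ * pullbackOne A α = pullbackOne A α * pullbackOne A ψ := by
    rw [← pullbackOne_comp_eq_mul, hψα, pullbackOne_comp_eq_mul]
  have hψβ' : pullbackOne A ψ * pullbackOne A β = pullbackOne A β * pullbackOne A ψ := by
    rw [← pullbackOne_comp_eq_mul, hψβ, pullbackOne_comp_eq_mul]
  have hEnd := fun χ ↦ pullbackOne_mem_adjoin_diagonal_of_forall_exists_zsmul_mem_closure_triple (n := n) hD χ
  exact weilClassesField_biproduct_le_divisorClassesSpan_iff_forall_dvd_of_forall_mem_adjoin_definiteQuaternionOver_diagonal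
    hA hh htop hnd hψsym hQm hQirr hψQ hα2' hqa hβ2' hqb hanti' hαskew hβskew hψα' hψβ' hPm hPe hPirr hφ her hEnd

/-- **TYPE 3 ON POWERS FROM `End(A)` — THE DICHOTOMY, EXCEPTIONAL SIDE**: under the same hypotheses,
`W_F ⊗ ℂ ⊓ 𝒟ᵐ ⊗ ℂ = ⊥` (all non-zero Weil classes exceptional) IFF at some complex root `ρ` of `P` and some root `z`
of `Q`, `2 dim(V_ρ ∩ ker((⊕ψ)^* - z))` is an odd multiple of `dim ker(ψ^* - z)`.
[cite: MoonenZarhin1998WeilClasses, §1 Criterion (2) («… Y is of Type 3, m ≥ 2 and the integer 2m·[E:ℚ]/[F:ℚ] is odd») and its proof (chunk p0003 L46–L60, L92–L111; p0004 L1–L27)]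
[cite: Milne1999LefschetzClasses, §1 p. 643, Thm. 3.2, Cor. 4.5] [cite: LangeBirkenhake1992, §1.1, Ch. 5 §5 (PDF p. 138)] -/
theorem weilClassesField_biproduct_inf_divisorClassesSpan_eq_bot_iff_exists_odd_of_definiteQuaternionOver_End
    (hA : 0 < A.dim) (hh : h ∈ hodgeClassSpan A.dim A.X 1) (htop : lefschetzPow h (A.dim - 1) 2 h ≠ 0)
    (hnd : ∀ x : complexBetti A.X 1, (∀ y, polarizationPairingOne A.X h (A.dim - 1) x y = 0) → x = 0)
    (hψsym : ∀ v w : complexBetti A.X 1, polarizationPairingOne A.X h (A.dim - 1) (pullbackOne A ψ v) w =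
      polarizationPairingOne A.X h (A.dim - 1) v (pullbackOne A ψ w))
    (hQm : Q.Monic) (hQirr : Irreducible (Q.map (Int.castRingHom ℚ)))
    (hψQ : Polynomial.eval₂ (Int.castRingHom (CategoryTheory.End A)) (ψ : CategoryTheory.End A) Q = 0)
    (hα2 : α ≫ α = Polynomial.eval₂ (Int.castRingHom (CategoryTheory.End A)) (ψ : CategoryTheory.End A) qa)
    (hqa : ∀ z : ℂ, (Q.map (Int.castRingHom ℂ)).IsRoot z → (qa.map (Int.castRingHom ℂ)).eval z ≠ 0)
    (hβ2 : β ≫ β = Polynomial.eval₂ (Int.castRingHom (CategoryTheory.End A)) (ψ : CategoryTheory.End A) qb)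
    (hqb : ∀ z : ℂ, (Q.map (Int.castRingHom ℂ)).IsRoot z → (qb.map (Int.castRingHom ℂ)).eval z ≠ 0)
    (hanti : α ≫ β = -(β ≫ α))
    (hαskew : ∀ v w : complexBetti A.X 1, polarizationPairingOne A.X h (A.dim - 1) (pullbackOne A α v) w =
      -polarizationPairingOne A.X h (A.dim - 1) v (pullbackOne A α w))
    (hβskew : ∀ v w : complexBetti A.X 1, polarizationPairingOne A.X h (A.dim - 1) (pullbackOne A β v) w =
      -polarizationPairingOne A.X h (A.dim - 1) v (pullbackOne A β w))
    (hψα : ψ ≫ α = α ≫ ψ) (hψβ : ψ ≫ β = β ≫ ψ)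
    (hD : ∀ g : A ⟶ A, ∃ N : ℤ, N ≠ 0 ∧ End.of (N • g) ∈ Subring.closure {End.of ψ, End.of α, End.of β})
    (hPm : P.Monic) (hPe : P.natDegree = e) (hPirr : Irreducible (P.map (Int.castRingHom ℚ)))
    (hφ : Polynomial.eval₂ (Int.castRingHom (CategoryTheory.End (⨁ (fun _ : Fin (n + 1) => A))))
      (φ : CategoryTheory.End (⨁ (fun _ : Fin (n + 1) => A))) P = 0)
    (her : e * (2 * m) = 2 * ((n + 1) * A.dim)) :
    weilClassesField (⨁ (fun _ : Fin (n + 1) => A)) φ P (2 * m) ⊓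
        divisorClassesSpan (⨁ (fun _ : Fin (n + 1) => A)).X (⨁ (fun _ : Fin (n + 1) => A)).dim m = ⊥ ↔
      ∃ ρ : ℂ, Polynomial.eval₂ (Int.castRingHom ℂ) ρ P = 0 ∧ ∃ z : ℂ, (Q.map (Int.castRingHom ℂ)).IsRoot z ∧
        ∃ j : ℕ, 2 * Module.finrank ℂ ↥((pullbackOne (⨁ (fun _ : Fin (n + 1) => A)) φ).eigenspace ρ ⊓
          (pullbackOne (⨁ (fun _ : Fin (n + 1) => A)) (biproduct.map fun _ : Fin (n + 1) => ψ)).eigenspace z) =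
          (2 * j + 1) * Module.finrank ℂ ↥((pullbackOne A ψ).eigenspace z) := by
  have hα2' : pullbackOne A α * pullbackOne A α = aeval (pullbackOne A ψ) (qa.map (Int.castRingHom ℂ)) := by
    rw [← pullbackOne_comp_eq_mul, hα2]
    exact pullbackOne_eval₂ ψ qa
  have hβ2' : pullbackOne A β * pullbackOne A β = aeval (pullbackOne A ψ) (qb.map (Int.castRingHom ℂ)) := by
    rw [← pullbackOne_comp_eq_mul, hβ2]
    exact pullbackOne_eval₂ ψ qb
  have hanti' : pullbackOne A α * pullbackOne A β = -(pullbackOne A β * pullbackOne A α) := by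
    rw [← pullbackOne_comp_eq_mul, hanti, pullbackOne_neg_eq_neg, pullbackOne_comp_eq_mul]
  have hψα' : pullbackOne A ψ * pullbackOne A α = pullbackOne A α * pullbackOne A ψ := by
    rw [← pullbackOne_comp_eq_mul, hψα, pullbackOne_comp_eq_mul]
  have hψβ' : pullbackOne A ψ * pullbackOne A β = pullbackOne A β * pullbackOne A ψ := by
    rw [← pullbackOne_comp_eq_mul, hψβ, pullbackOne_comp_eq_mul]
  have hEnd := fun χ ↦ pullbackOne_mem_adjoin_diagonal_of_forall_exists_zsmul_mem_closure_triple (n := n) hD χ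
  exact weilClassesField_biproduct_inf_divisorClassesSpan_eq_bot_iff_exists_odd_of_forall_mem_adjoin_definiteQuaternionOver_diagonal
    hA hh htop hnd hψsym hQm hQirr hψQ hα2' hqa hβ2' hqb hanti' hαskew hβskew hψα' hψβ' hPm hPe hPirr hφ her hEnd

/-- **TYPE 3 OVER `ℚ` ON POWERS FROM `End(A)`: `W_F(A^{n+1}) ⊗ ℂ ≤ 𝒟ᵐ ⊗ ℂ ↔ dim A ∣ m`** — for `α, β ∈ End(A)`
Rosati-skew, `αβ = -βα`, `α² = [a]`, `β² = [b]` (`a, b ∈ ℤ ∖ {0}`), «`End⁰(A) = ℚ⟨α, β⟩`» (every `g ∈ End(A)` has a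
non-zero multiple in `ℤ⟨α, β⟩`), product polarization, `P(φ) = 0`, `e · 2m = 2(n+1) dim A`: the print's «`2m′/[F:ℚ]`
even», `E = ℚ`, `m′ = n + 1`. [cite: MoonenZarhin1998WeilClasses, §1 Criterion (2), case «Type 3, m ≥ 2» with E = ℚ (chunk p0003 L46–L60, L92–L111)]
[cite: Milne1999LefschetzClasses, §1 p. 643, Thm. 3.2, Cor. 4.5] -/
theorem weilClassesField_biproduct_le_divisorClassesSpan_iff_dvd_of_definiteQuaternion_End
    (hA : 0 < A.dim) (hh : h ∈ hodgeClassSpan A.dim A.X 1) (htop : lefschetzPow h (A.dim - 1) 2 h ≠ 0)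
    (hnd : ∀ x : complexBetti A.X 1, (∀ y, polarizationPairingOne A.X h (A.dim - 1) x y = 0) → x = 0)
    (ha : a ≠ 0) (hα2 : α ≫ α = a • 𝟙 A) (hb : b ≠ 0) (hβ2 : β ≫ β = b • 𝟙 A) (hanti : α ≫ β = -(β ≫ α))
    (hαskew : ∀ v w : complexBetti A.X 1, polarizationPairingOne A.X h (A.dim - 1) (pullbackOne A α v) w =
      -polarizationPairingOne A.X h (A.dim - 1) v (pullbackOne A α w))
    (hβskew : ∀ v w : complexBetti A.X 1, polarizationPairingOne A.X h (A.dim - 1) (pullbackOne A β v) w =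
      -polarizationPairingOne A.X h (A.dim - 1) v (pullbackOne A β w))
    (hD : ∀ g : A ⟶ A, ∃ N : ℤ, N ≠ 0 ∧ End.of (N • g) ∈ Subring.closure {End.of (𝟙 A), End.of α, End.of β})
    (hPm : P.Monic) (hPe : P.natDegree = e) (hPirr : Irreducible (P.map (Int.castRingHom ℚ)))
    (hφ : Polynomial.eval₂ (Int.castRingHom (CategoryTheory.End (⨁ (fun _ : Fin (n + 1) => A))))
      (φ : CategoryTheory.End (⨁ (fun _ : Fin (n + 1) => A))) P = 0)
    (her : e * (2 * m) = 2 * ((n + 1) * A.dim)) :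
    weilClassesField (⨁ (fun _ : Fin (n + 1) => A)) φ P (2 * m) ≤
      divisorClassesSpan (⨁ (fun _ : Fin (n + 1) => A)).X (⨁ (fun _ : Fin (n + 1) => A)).dim m ↔ A.dim ∣ m := by
  have hα2' : pullbackOne A α * pullbackOne A α = (a : ℂ) • 1 := by
    rw [← pullbackOne_comp_eq_mul, hα2, pullbackOne_zsmul_id]
  have hβ2' : pullbackOne A β * pullbackOne A β = (b : ℂ) • 1 := by
    rw [← pullbackOne_comp_eq_mul, hβ2, pullbackOne_zsmul_id]
  have hanti' : pullbackOne A α * pullbackOne A β = -(pullbackOne A β * pullbackOne A α) := by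
    rw [← pullbackOne_comp_eq_mul, hanti, pullbackOne_neg_eq_neg, pullbackOne_comp_eq_mul]
  have hT1 : pullbackOne (⨁ (fun _ : Fin (n + 1) => A)) (biproduct.map fun _ : Fin (n + 1) => 𝟙 A) = 1 := by
    have e1 : (biproduct.map fun _ : Fin (n + 1) => 𝟙 A) = 𝟙 (⨁ (fun _ : Fin (n + 1) => A)) :=
      biproduct.hom_ext _ _ fun j ↦ by rw [biproduct.map_π, Category.comp_id, Category.id_comp]
    rw [e1, pullbackOne_id_eq_one]
  have hEnd : ∀ χ : (⨁ (fun _ : Fin (n + 1) => A)) ⟶ (⨁ (fun _ : Fin (n + 1) => A)), pullbackOne (⨁ (fun _ : Fin (n + 1) => A)) χ ∈ Algebra.adjoin ℂ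
      (insert (pullbackOne (⨁ (fun _ : Fin (n + 1) => A)) (biproduct.map fun _ : Fin (n + 1) => α))
        (insert (pullbackOne (⨁ (fun _ : Fin (n + 1) => A)) (biproduct.map fun _ : Fin (n + 1) => β))
          (Set.range fun ab : Fin (n + 1) × Fin (n + 1) ↦ pullbackOne (⨁ (fun _ : Fin (n + 1) => A))
              (biproduct.π (fun _ : Fin (n + 1) => A) ab.1 ≫ biproduct.ι (fun _ : Fin (n + 1) => A) ab.2)))) := fun χ ↦ by
    have h1 := pullbackOne_mem_adjoin_diagonal_of_forall_exists_zsmul_mem_closure_triple (n := n) hD χ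
    rw [hT1] at h1
    refine Algebra.adjoin_le (Set.insert_subset_iff.2 ⟨Subalgebra.one_mem _, Algebra.subset_adjoin⟩) h1
  exact weilClassesField_biproduct_le_divisorClassesSpan_iff_dvd_of_forall_mem_adjoin_definiteQuaternion_diagonal hA hh htop
    hnd (Int.cast_ne_zero.2 ha) hα2' (Int.cast_ne_zero.2 hb) hβ2' hanti' hαskew hβskew hPm hPe hPirr hφ her hEnd

/-- **… and `W_F(A^{n+1}) ⊗ ℂ ⊓ 𝒟ᵐ ⊗ ℂ = ⊥ ↔ dim A ∤ m`** («`2m′/[F:ℚ]` odd», `E = ℚ`), from `End(A)`.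
[cite: MoonenZarhin1998WeilClasses, §1 Criterion (2), case «Type 3, m ≥ 2, 2m·[E:ℚ]/[F:ℚ] odd» with E = ℚ (chunk p0003 L46–L60, L92–L111)]
[cite: Milne1999LefschetzClasses, §1 p. 643, Thm. 3.2, Cor. 4.5] -/
theorem weilClassesField_biproduct_inf_divisorClassesSpan_eq_bot_iff_not_dvd_of_definiteQuaternion_End
    (hA : 0 < A.dim) (hh : h ∈ hodgeClassSpan A.dim A.X 1) (htop : lefschetzPow h (A.dim - 1) 2 h ≠ 0)
    (hnd : ∀ x : complexBetti A.X 1, (∀ y, polarizationPairingOne A.X h (A.dim - 1) x y = 0) → x = 0)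
    (ha : a ≠ 0) (hα2 : α ≫ α = a • 𝟙 A) (hb : b ≠ 0) (hβ2 : β ≫ β = b • 𝟙 A) (hanti : α ≫ β = -(β ≫ α))
    (hαskew : ∀ v w : complexBetti A.X 1, polarizationPairingOne A.X h (A.dim - 1) (pullbackOne A α v) w =
      -polarizationPairingOne A.X h (A.dim - 1) v (pullbackOne A α w))
    (hβskew : ∀ v w : complexBetti A.X 1, polarizationPairingOne A.X h (A.dim - 1) (pullbackOne A β v) w =
      -polarizationPairingOne A.X h (A.dim - 1) v (pullbackOne A β w))
    (hD : ∀ g : A ⟶ A, ∃ N : ℤ, N ≠ 0 ∧ End.of (N • g) ∈ Subring.closure {End.of (𝟙 A), End.of α, End.of β})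
    (hPm : P.Monic) (hPe : P.natDegree = e) (hPirr : Irreducible (P.map (Int.castRingHom ℚ)))
    (hφ : Polynomial.eval₂ (Int.castRingHom (CategoryTheory.End (⨁ (fun _ : Fin (n + 1) => A))))
      (φ : CategoryTheory.End (⨁ (fun _ : Fin (n + 1) => A))) P = 0)
    (her : e * (2 * m) = 2 * ((n + 1) * A.dim)) :
    weilClassesField (⨁ (fun _ : Fin (n + 1) => A)) φ P (2 * m) ⊓
      divisorClassesSpan (⨁ (fun _ : Fin (n + 1) => A)).X (⨁ (fun _ : Fin (n + 1) => A)).dim m = ⊥ ↔ ¬ A.dim ∣ m := by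
  have hα2' : pullbackOne A α * pullbackOne A α = (a : ℂ) • 1 := by
    rw [← pullbackOne_comp_eq_mul, hα2, pullbackOne_zsmul_id]
  have hβ2' : pullbackOne A β * pullbackOne A β = (b : ℂ) • 1 := by
    rw [← pullbackOne_comp_eq_mul, hβ2, pullbackOne_zsmul_id]
  have hanti' : pullbackOne A α * pullbackOne A β = -(pullbackOne A β * pullbackOne A α) := by
    rw [← pullbackOne_comp_eq_mul, hanti, pullbackOne_neg_eq_neg, pullbackOne_comp_eq_mul]
  have hT1 : pullbackOne (⨁ (fun _ : Fin (n + 1) => A)) (biproduct.map fun _ : Fin (n + 1) => 𝟙 A) = 1 := by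
    have e1 : (biproduct.map fun _ : Fin (n + 1) => 𝟙 A) = 𝟙 (⨁ (fun _ : Fin (n + 1) => A)) :=
      biproduct.hom_ext _ _ fun j ↦ by rw [biproduct.map_π, Category.comp_id, Category.id_comp]
    rw [e1, pullbackOne_id_eq_one]
  have hEnd : ∀ χ : (⨁ (fun _ : Fin (n + 1) => A)) ⟶ (⨁ (fun _ : Fin (n + 1) => A)), pullbackOne (⨁ (fun _ : Fin (n + 1) => A)) χ ∈ Algebra.adjoin ℂ
      (insert (pullbackOne (⨁ (fun _ : Fin (n + 1) => A)) (biproduct.map fun _ : Fin (n + 1) => α))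
        (insert (pullbackOne (⨁ (fun _ : Fin (n + 1) => A)) (biproduct.map fun _ : Fin (n + 1) => β))
          (Set.range fun ab : Fin (n + 1) × Fin (n + 1) ↦ pullbackOne (⨁ (fun _ : Fin (n + 1) => A))
              (biproduct.π (fun _ : Fin (n + 1) => A) ab.1 ≫ biproduct.ι (fun _ : Fin (n + 1) => A) ab.2)))) := fun χ ↦ by
    have h1 := pullbackOne_mem_adjoin_diagonal_of_forall_exists_zsmul_mem_closure_triple (n := n) hD χ
    rw [hT1] at h1
    refine Algebra.adjoin_le (Set.insert_subset_iff.2 ⟨Subalgebra.one_mem _, Algebra.subset_adjoin⟩) h1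
  exact weilClassesField_biproduct_inf_divisorClassesSpan_eq_bot_iff_not_dvd_of_forall_mem_adjoin_definiteQuaternion_diagonal
    hA hh htop hnd (Int.cast_ne_zero.2 ha) hα2' (Int.cast_ne_zero.2 hb) hβ2' hanti' hαskew hβskew hPm hPe hPirr hφ her hEnd

end EndLevel

end Literature.AlgebraicGeometry.HodgeTheory

end
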